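import Summits.AtomisticToContinuum.Crystallization.Theorems.OverbindingBudgetAffineDualBesselKernel

/-!
# Dual Bessel kernel — SOUNDNESS `DualRow.check_sound` and the hcp demo rows

g66 Deliverable B, part 3/3.  ★★ `DualRow.check_sound`: if `R.check = true`, then for every pair `b₀, b₁` spanning a real inner
product plane whose Gram matrix lies in the row's enclosures and every `d ≥ R.dlo`,
`Σ'_{w ∈ (span_ℤ{b₀,b₁})^*} dualBesselTerm R.μ d ‖w‖ ≤ R.bound`.
Proof: majorant `GQ` on `ℤ² ≅ Λ^*` (origin ↦ 0; box points ↦ clipped certified box term via the norm window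
`rlo ≤ ‖w_z‖ ≤ rhi` obtained from `rlo²·Dhi ≤ Qlo(z)`, `Qhi(z) ≤ rhi²·Dlo`; outside the box ↦ separable geometric tail from
`‖w_z‖ ≥ κ|z|₁`, `e^{−δβ} ≤ 1/2`), `Summable.sum_add_tsum_compl` over the box, `List.sum_toFinset`.
Demo rows (hcp far layer `k = 4`) and usage corollaries: `…DualBesselDemo`.  No `sorry`; axioms standard.
-/

noncomputable section

open Real Set Finset
open scoped BigOperators InnerProductSpace

namespace Summit.AtomisticToContinuum.Crystallization.Theorems.OverbindingBudgetAffineFarSmoothSplit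

open Literature.Analysis.FunctionSpaces Literature.Algebra.EuclideanLattices

-- the three interval helpers are PRIVATE in `…DualBesselKernel` (dedup gate); private copies for this file:
/-- Interval helper `min_mul_le_mul` — PRIVATE copy (public twin: `Literature.Analysis.FluidPDE.PlanarKinematics.StepQ.min_le_mul`, not imported into this chain; dedup gate p850483). [formal bookkeeping] -/
private theorem min_mul_le_mul {c lo hi x : ℝ} (hlo : lo ≤ x) (hhi : x ≤ hi) : min (c * lo) (c * hi) ≤ c * x := by
  rcases le_total 0 c with hc | hc
  · exact (min_le_left _ _).trans (mul_le_mul_of_nonneg_left hlo hc)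
  · exact (min_le_right _ _).trans (mul_le_mul_of_nonpos_left hhi hc)

/-- Interval helper `mul_le_max_mul` — PRIVATE copy (public twin: `Literature.Analysis.FluidPDE.PlanarKinematics.StepQ.mul_le_max`, not imported into this chain; dedup gate p850483). [formal bookkeeping] -/
private theorem mul_le_max_mul {c lo hi x : ℝ} (hlo : lo ≤ x) (hhi : x ≤ hi) : c * x ≤ max (c * lo) (c * hi) := by
  rcases le_total 0 c with hc | hc
  · exact (mul_le_mul_of_nonneg_left hhi hc).trans (le_max_right _ _)
  · exact (mul_le_mul_of_nonpos_left hlo hc).trans (le_max_left _ _)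

/-- Interval helper `sq_le_max_sq` — PRIVATE copy (public twin: `…LoopTunnelDialForcePricing.sq_le_max_sq`, not imported into this chain; dedup gate p850483). [formal bookkeeping] -/
private theorem sq_le_max_sq {lo hi x : ℝ} (hlo : lo ≤ x) (hhi : x ≤ hi) : x ^ 2 ≤ max (lo ^ 2) (hi ^ 2) := by
  rcases le_total 0 x with hx | hx
  · exact (pow_le_pow_left₀ hx hhi 2).trans (le_max_right _ _)
  · exact le_trans (by nlinarith) (le_max_left _ _)

section Sound

variable {V : Type*} [NormedAddCommGroup V] [InnerProductSpace ℝ V]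

namespace DualRow

variable (R : DualRow)

/-- `Qlo_le` (docstring added by the landing lane; see the module docstring). [formal bookkeeping] -/
theorem Qlo_le (z : ℤ × ℤ) {g00 g01 g11 : ℝ} (h00 : (R.g00lo : ℝ) ≤ g00) (h01 : (R.g01lo : ℝ) ≤ g01 ∧ g01 ≤ R.g01hi) (h11 : (R.g11lo : ℝ) ≤ g11) :
    ((R.Qlo z : ℚ) : ℝ) ≤ g11 * (z.1 : ℝ) ^ 2 - 2 * g01 * z.1 * z.2 + g00 * (z.2 : ℝ) ^ 2 := by
  have hm := min_mul_le_mul (c := -2 * (z.1 : ℝ) * z.2) h01.1 h01.2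
  simp only [Qlo]; push_cast
  nlinarith [mul_le_mul_of_nonneg_right h11 (sq_nonneg (z.1 : ℝ)), mul_le_mul_of_nonneg_right h00 (sq_nonneg (z.2 : ℝ))]

/-- `le_Qhi` (docstring added by the landing lane; see the module docstring). [formal bookkeeping] -/
theorem le_Qhi (z : ℤ × ℤ) {g00 g01 g11 : ℝ} (h00 : g00 ≤ R.g00hi) (h01 : (R.g01lo : ℝ) ≤ g01 ∧ g01 ≤ R.g01hi) (h11 : g11 ≤ R.g11hi) :
    g11 * (z.1 : ℝ) ^ 2 - 2 * g01 * z.1 * z.2 + g00 * (z.2 : ℝ) ^ 2 ≤ ((R.Qhi z : ℚ) : ℝ) := by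
  have hm := mul_le_max_mul (c := -2 * (z.1 : ℝ) * z.2) h01.1 h01.2
  simp only [Qhi]; push_cast
  nlinarith [mul_le_mul_of_nonneg_right h11 (sq_nonneg (z.1 : ℝ)), mul_le_mul_of_nonneg_right h00 (sq_nonneg (z.2 : ℝ))]

/-- `Dlo_le` (docstring added by the landing lane; see the module docstring). [formal bookkeeping] -/
theorem Dlo_le {g00 g01 g11 : ℝ} (hg : 0 ≤ R.g00lo) (hg' : 0 ≤ R.g11lo) (h00 : (R.g00lo : ℝ) ≤ g00) (h01 : (R.g01lo : ℝ) ≤ g01 ∧ g01 ≤ R.g01hi)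
    (h11 : (R.g11lo : ℝ) ≤ g11) : ((R.Dlo : ℚ) : ℝ) ≤ g00 * g11 - g01 ^ 2 := by
  have hs := sq_le_max_sq h01.1 h01.2
  have hp : (R.g00lo : ℝ) * R.g11lo ≤ g00 * g11 := mul_le_mul h00 h11 (by exact_mod_cast hg') ((Rat.cast_nonneg.2 hg).trans h00)
  simp only [Dlo]; push_cast; linarith

/-- `le_Dhi` (docstring added by the landing lane; see the module docstring). [formal bookkeeping] -/
theorem le_Dhi {g00 g01 g11 : ℝ} (hg0 : 0 ≤ g00) (h00 : g00 ≤ R.g00hi) (h01 : (R.g01lo : ℝ) ≤ g01 ∧ g01 ≤ R.g01hi) (hg1 : 0 ≤ g11)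
    (h11 : g11 ≤ R.g11hi) : g00 * g11 - g01 ^ 2 ≤ ((R.Dhi : ℚ) : ℝ) := by
  have hp : g00 * g11 ≤ (R.g00hi : ℝ) * R.g11hi := mul_le_mul h00 h11 hg1 (hg0.trans h00)
  have hs : ((R.g01sqlo : ℚ) : ℝ) ≤ g01 ^ 2 := by
    simp only [g01sqlo]; split_ifs with h h'
    · push_cast; have : (0:ℝ) ≤ R.g01lo := by exact_mod_cast h
      exact pow_le_pow_left₀ this h01.1 2
    · push_cast; have : (R.g01hi : ℝ) ≤ 0 := by exact_mod_cast h'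
      nlinarith [h01.2]
    · push_cast; positivity
  simp only [Dhi]; push_cast; linarith

/-- ★★ **Soundness of the dual Bessel kernel.**  If `R.check = true`, then for every pair `b₀, b₁` spanning the real inner product
plane `V` whose Gram matrix lies in the row's enclosures, and every `d ≥ dlo`,
`Σ'_{w ∈ Λ(b)^*} (π‖w‖/d)^μ K_μ(2π d ‖w‖) ≤ R.bound`.  The proof compares with the explicit majorant `GQ` on `ℤ² ≅ Λ^*`
(box witnesses + separable geometric tail, `Σ_{ℤ²} (1/2)^{|z|₁} = 9`). [this file] -/
theorem check_sound (hR : R.check = true) (b : Fin 2 → V) (hspan : ∀ v : V, v ∈ Submodule.span ℝ (Set.range b))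
    (h00 : (R.g00lo : ℝ) ≤ ‖b 0‖ ^ 2 ∧ ‖b 0‖ ^ 2 ≤ R.g00hi) (h01 : (R.g01lo : ℝ) ≤ ⟪b 0, b 1⟫_ℝ ∧ ⟪b 0, b 1⟫_ℝ ≤ R.g01hi)
    (h11 : (R.g11lo : ℝ) ≤ ‖b 1‖ ^ 2 ∧ ‖b 1‖ ^ 2 ≤ R.g11hi) {d : ℝ} (hd : (R.dlo : ℝ) ≤ d) :
    ∑' w : dualLattice (Submodule.span ℤ (Set.range b)), dualBesselTerm R.μ d ‖(w : V)‖ ≤ R.bound := by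
  -- unpack the certificate
  have hR' := hR
  simp only [check, Bool.and_eq_true, decide_eq_true_eq, List.all_eq_true, Bool.or_eq_true] at hR'
  obtain ⟨⟨⟨⟨⟨⟨⟨⟨⟨⟨⟨⟨⟨⟨⟨⟨⟨⟨hμ, hdlo⟩, hg00⟩, hg11⟩, -⟩, -⟩, -⟩, hDlo⟩, hall⟩, hThi⟩, hκ⟩, hκT⟩, hμy⟩, hNt⟩, hst⟩, hst'⟩, hNr⟩,
    hrho⟩, hbound⟩ := hR'
  have hμ0 : R.μ ≠ 0 := by omega
  have hdlo' : (0 : ℝ) < R.dlo := by exact_mod_cast hdlo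
  have hph := pi_lt_piHi
  have hph0 : (0 : ℝ) < ((piHi : ℚ) : ℝ) := lt_trans Real.pi_pos hph
  have hpl0 := piLo_pos
  -- the Gram determinant
  have hD : ((R.Dlo : ℚ) : ℝ) ≤ ‖b 0‖ ^ 2 * ‖b 1‖ ^ 2 - ⟪b 0, b 1⟫_ℝ ^ 2 := R.Dlo_le hg00.le hg11.le h00.1 h01 h11.1
  have hD' : ‖b 0‖ ^ 2 * ‖b 1‖ ^ 2 - ⟪b 0, b 1⟫_ℝ ^ 2 ≤ ((R.Dhi : ℚ) : ℝ) := R.le_Dhi (by positivity) h00.2 h01 (by positivity) h11.2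
  have hDpos : 0 < ‖b 0‖ ^ 2 * ‖b 1‖ ^ 2 - ⟪b 0, b 1⟫_ℝ ^ 2 := lt_of_lt_of_le (by exact_mod_cast hDlo) hD
  have htr : ‖b 0‖ ^ 2 + ‖b 1‖ ^ 2 ≤ R.Thi := by
    have := (Rat.cast_le (K := ℝ)).2 hThi; push_cast at this; linarith [h00.2, h11.2]
  -- the majorant and its tail
  set G : ℤ × ℤ → ℝ := fun z => ((R.GQ z : ℚ) : ℝ) with hGdef
  have htailC : (0 : ℝ) ≤ R.tailC := by exact_mod_cast le_max_left 0 _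
  set TM : ℤ × ℤ → ℝ := fun z => (R.tailC : ℝ) * 2 ^ (R.Z + 1) * ((1 / 2 : ℝ) ^ z.1.natAbs * (1 / 2 : ℝ) ^ z.2.natAbs) with hTM
  have hTM0 : ∀ z, 0 ≤ TM z := fun z => by positivity
  have hTMs : Summable TM := summable_half_pow_pair.mul_left _
  have hTMsum : HasSum TM ((R.tailC : ℝ) * 2 ^ (R.Z + 1) * 9) := hasSum_half_pow_pair.mul_left _
  have hGtail : ∀ z : ℤ × ℤ, ¬ (|z.1| ≤ (R.Z : ℤ) ∧ |z.2| ≤ (R.Z : ℤ)) → G z = TM z := by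
    intro z hz
    have hz0 : z ≠ 0 := by rintro rfl; exact hz ⟨by simp, by simp⟩
    simp only [hGdef, hTM, GQ, hz0, hz, if_false, pow_add]; push_cast; ring
  have hGbox : ∀ z : ℤ × ℤ, z ≠ 0 → (|z.1| ≤ (R.Z : ℤ) ∧ |z.2| ≤ (R.Z : ℤ)) →
      G z = ((match R.find z with | some e => max 0 (R.boxTerm e) | none => 0 : ℚ) : ℝ) := by
    intro z hz0 hz
    simp only [hGdef, GQ, hz0, if_false, if_pos hz]
    rfl  -- (landing lane: across the module boundary the two `match` auxiliaries are distinct constants; `rfl` unfolds both)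
  have hG0 : ∀ z, 0 ≤ G z := by
    intro z
    by_cases hz : |z.1| ≤ (R.Z : ℤ) ∧ |z.2| ≤ (R.Z : ℤ)
    · by_cases hz0 : z = 0
      · simp [hGdef, GQ, hz0]
      · rw [hGbox z hz0 hz]; split
        · exact_mod_cast le_max_left _ _
        · simp
    · rw [hGtail z hz]; exact hTM0 z
  set S : Finset (ℤ × ℤ) := (boxPts R.Z).toFinset with hS
  have hmemS : ∀ z, z ∈ S ↔ |z.1| ≤ (R.Z : ℤ) ∧ |z.2| ≤ (R.Z : ℤ) := fun z => by rw [hS, List.mem_toFinset, mem_boxPts]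
  have hGs : Summable G := by
    have hfin : Summable (fun z => if z ∈ S then G z else 0) :=
      summable_of_ne_finset_zero (s := S) (fun z hz => if_neg hz)
    refine (hTMs.add hfin).of_nonneg_of_le hG0 fun z => ?_
    by_cases hz : z ∈ S
    · simp only [hz, if_true]; linarith [hTM0 z]
    · rw [if_neg hz, add_zero, hGtail z ((hmemS z).not.1 hz)]
  -- pointwise domination
  have hdom : ∀ (w : V) (z : ℤ × ℤ), w ∈ dualLattice (Submodule.span ℤ (Set.range b)) →
      (z.1 : ℝ) = ⟪w, b 0⟫_ℝ → (z.2 : ℝ) = ⟪w, b 1⟫_ℝ → dualBesselTerm R.μ d ‖w‖ ≤ G z := by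
    intro w z _ hz1 hz2
    have hQ : ‖w‖ ^ 2 * (‖b 0‖ ^ 2 * ‖b 1‖ ^ 2 - ⟪b 0, b 1⟫_ℝ ^ 2) =
        ‖b 1‖ ^ 2 * (z.1 : ℝ) ^ 2 - 2 * ⟪b 0, b 1⟫_ℝ * z.1 * z.2 + ‖b 0‖ ^ 2 * (z.2 : ℝ) ^ 2 := by
      have := norm_sq_mul_gramDet_eq b (hspan w); rw [← hz1, ← hz2] at this; linear_combination this
    by_cases hz0 : z = 0
    · subst hz0
      have hw : w = 0 := eq_zero_of_inner_eq_zero b (hspan w) (by simpa using hz1.symm) (by simpa using hz2.symm)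
      have : G 0 = 0 := by simp [hGdef, GQ]
      rw [this, hw, norm_zero, dualBesselTerm_zero hμ0]
    by_cases hbox : |z.1| ≤ (R.Z : ℤ) ∧ |z.2| ≤ (R.Z : ℤ)
    · -- box point: use its witness
      obtain h | h := hall z (mem_boxPts.2 hbox)
      · exact absurd h hz0
      cases hf : R.find z with
      | none => simp [hf] at h
      | some e =>
        simp only [hf, ptOK, Bool.and_eq_true, decide_eq_true_eq] at h
        obtain ⟨⟨⟨⟨⟨⟨hrlo, hrr⟩, hQl⟩, hQh⟩, hN⟩, hs⟩, hs'⟩ := h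
        have hGz : G z = ((max 0 (R.boxTerm e) : ℚ) : ℝ) := by rw [hGbox z hz0 hbox, hf]
        have hmax : ((R.boxTerm e : ℚ) : ℝ) ≤ ((max 0 (R.boxTerm e) : ℚ) : ℝ) := by exact_mod_cast le_max_right _ _
        rw [hGz]
        refine le_trans ?_ hmax
        have hrlo' : (0 : ℝ) < e.rlo := by exact_mod_cast hrlo
        have hrhi' : (0 : ℝ) < e.rhi := by exact_mod_cast lt_of_lt_of_le hrlo hrr
        -- the norm window `rlo ≤ ‖w‖ ≤ rhi`
        have hQl' := (Rat.cast_le (K := ℝ)).2 hQl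
        have hQh' := (Rat.cast_le (K := ℝ)).2 hQh
        push_cast at hQl' hQh'
        have hQlo := R.Qlo_le z h00.1 h01 h11.1
        have hQhi := R.le_Qhi z h00.2 h01 h11.2
        have hlo : (e.rlo : ℝ) ≤ ‖w‖ := by
          have h1 : (e.rlo : ℝ) ^ 2 * (‖b 0‖ ^ 2 * ‖b 1‖ ^ 2 - ⟪b 0, b 1⟫_ℝ ^ 2) ≤
              ‖w‖ ^ 2 * (‖b 0‖ ^ 2 * ‖b 1‖ ^ 2 - ⟪b 0, b 1⟫_ℝ ^ 2) := by
            rw [hQ]; linarith [mul_le_mul_of_nonneg_left hD' (sq_nonneg (e.rlo : ℝ))]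
          exact (pow_le_pow_iff_left₀ hrlo'.le (norm_nonneg w) two_ne_zero).1 (le_of_mul_le_mul_right h1 hDpos)
        have hhi : ‖w‖ ≤ (e.rhi : ℝ) := by
          have h1 : ‖w‖ ^ 2 * (‖b 0‖ ^ 2 * ‖b 1‖ ^ 2 - ⟪b 0, b 1⟫_ℝ ^ 2) ≤
              (e.rhi : ℝ) ^ 2 * (‖b 0‖ ^ 2 * ‖b 1‖ ^ 2 - ⟪b 0, b 1⟫_ℝ ^ 2) := by
            rw [hQ]; linarith [mul_le_mul_of_nonneg_left hD (sq_nonneg (e.rhi : ℝ))]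
          exact (pow_le_pow_iff_left₀ (norm_nonneg w) hrhi'.le two_ne_zero).1 (le_of_mul_le_mul_right h1 hDpos)
        -- the box bound and its rational certificates
        have hbox' := dualBesselTerm_le_box R.μ hdlo' hd hrlo' hlo hhi
        have hyloR : ((R.ylo e : ℚ) : ℝ) = 2 * ((piLo : ℚ) : ℝ) * R.dlo * e.rlo := by simp only [ylo]; push_cast; ring
        rw [← hyloR] at hbox'
        have hylo0 : (0 : ℝ) < ((R.ylo e : ℚ) : ℝ) := by rw [hyloR]; positivity
        have hs0 : (0 : ℝ) ≤ e.s := by exact_mod_cast hs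
        have hsq : Real.sqrt (π / (2 * ((R.ylo e : ℚ) : ℝ))) ≤ e.s := by
          refine sqrt_le_of_sq hs0 (le_trans ?_ (by have := (Rat.cast_le (K := ℝ)).2 hs'; push_cast at this; exact this))
          exact div_le_div_of_nonneg_right hph.le (by positivity)
        have hexp : Real.exp (-((R.ylo e : ℚ) : ℝ)) ≤ ((expUB e.N (R.ylo e) : ℚ) : ℝ) := exp_neg_le_expUB hN
        have hE0 : (0 : ℝ) ≤ ((expUB e.N (R.ylo e) : ℚ) : ℝ) := (Real.exp_pos _).le.trans hexp
        have hlad : ladder R.μ ((R.ylo e : ℚ) : ℝ) = ((ladderQ R.μ (R.ylo e) : ℚ) : ℝ) := (ladderQ_cast _ _).symm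
        have hA : (0 : ℝ) ≤ (((piHi : ℚ) : ℝ) * e.rhi / R.dlo) ^ R.μ := by positivity
        have key : Real.sqrt (π / (2 * ((R.ylo e : ℚ) : ℝ))) * Real.exp (-((R.ylo e : ℚ) : ℝ)) * ladder R.μ ((R.ylo e : ℚ) : ℝ) ≤
            (e.s : ℝ) * ((expUB e.N (R.ylo e) : ℚ) : ℝ) * ((ladderQ R.μ (R.ylo e) : ℚ) : ℝ) :=
          mul_le_mul (mul_le_mul hsq hexp (Real.exp_pos _).le hs0) hlad.le (ladder_pos _ hylo0).le (mul_nonneg hs0 hE0)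
        calc dualBesselTerm R.μ d ‖w‖ ≤ _ := hbox'
          _ ≤ (((piHi : ℚ) : ℝ) * e.rhi / R.dlo) ^ R.μ * ((e.s : ℝ) * ((expUB e.N (R.ylo e) : ℚ) : ℝ) * ((ladderQ R.μ (R.ylo e) : ℚ) : ℝ)) :=
              mul_le_mul_of_nonneg_left key hA
          _ = ((R.boxTerm e : ℚ) : ℝ) := by simp only [boxTerm]; push_cast; ring
    · -- tail point
      have hL : R.Z + 1 ≤ z.1.natAbs + z.2.natAbs := by
        rw [← Int.natCast_natAbs, ← Int.natCast_natAbs] at hbox; omega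
      set L : ℕ := z.1.natAbs + z.2.natAbs with hLdef
      have hLr : (L : ℝ) = |(z.1 : ℝ)| + |(z.2 : ℝ)| := by rw [hLdef, Nat.cast_add, Nat.cast_natAbs, Nat.cast_natAbs, Int.cast_abs, Int.cast_abs]
      have hκ' : (0 : ℝ) < R.κ := by exact_mod_cast hκ
      have hκT' : (R.κ : ℝ) ^ 2 * (2 * R.Thi) ≤ 1 := by exact_mod_cast hκT
      have hr : (R.κ : ℝ) * L ≤ ‖w‖ := by
        have h1 := inner_sq_add_inner_sq_le b (hspan w) hDpos
        rw [← hz1, ← hz2] at h1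
        have h2 : (z.1 : ℝ) ^ 2 + (z.2 : ℝ) ^ 2 ≤ ‖w‖ ^ 2 * R.Thi := h1.trans (mul_le_mul_of_nonneg_left htr (sq_nonneg _))
        have h3 : (|(z.1 : ℝ)| + |(z.2 : ℝ)|) ^ 2 ≤ 2 * ((z.1 : ℝ) ^ 2 + (z.2 : ℝ) ^ 2) := by
          nlinarith [sq_abs (z.1 : ℝ), sq_abs (z.2 : ℝ), sq_nonneg (|(z.1 : ℝ)| - |(z.2 : ℝ)|)]
        have h4 : ((R.κ : ℝ) * L) ^ 2 ≤ ‖w‖ ^ 2 := by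
          rw [hLr, mul_pow]
          have h5 := mul_le_mul_of_nonneg_left (h3.trans (by linarith [h2] : _ ≤ 2 * (‖w‖ ^ 2 * R.Thi))) (sq_nonneg (R.κ : ℝ))
          have h6 := mul_le_mul_of_nonneg_right hκT' (sq_nonneg ‖w‖)
          linarith
        exact (pow_le_pow_iff_left₀ (by positivity) (norm_nonneg w) two_ne_zero).1 h4
      have hLreal : (R.Z : ℝ) + 1 ≤ (L : ℝ) := by exact_mod_cast hL
      have hβR : ((R.β : ℚ) : ℝ) = 2 * ((piLo : ℚ) : ℝ) * R.dlo * R.κ := by simp only [β]; push_cast; ring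
      have hy1R : ((R.y₁ : ℚ) : ℝ) = 2 * ((piLo : ℚ) : ℝ) * R.dlo * R.κ * ((R.Z : ℝ) + 1) := by simp only [y₁, β]; push_cast; ring
      have hμ' : (R.μ : ℝ) < 2 * ((piLo : ℚ) : ℝ) * R.dlo * R.κ * ((R.Z : ℝ) + 1) := by
        rw [← hy1R]; exact_mod_cast hμy
      have htail := dualBesselTerm_le_tail R.μ hdlo' hd hκ' hLreal hr hμ'
      rw [← hy1R, ← hβR] at htail
      have hy10 : (0 : ℝ) < ((R.y₁ : ℚ) : ℝ) := by rw [hy1R]; positivity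
      -- the envelope constant
      have hst0 : (0 : ℝ) ≤ R.stail := by exact_mod_cast hst
      have hsq : Real.sqrt (π / (2 * ((R.y₁ : ℚ) : ℝ))) ≤ R.stail := by
        refine sqrt_le_of_sq hst0 (le_trans ?_ (by have := (Rat.cast_le (K := ℝ)).2 hst'; push_cast at this; exact this))
        exact div_le_div_of_nonneg_right hph.le (by positivity)
      have hexp : Real.exp (-((R.y₁ : ℚ) : ℝ)) ≤ ((expUB R.Ntail R.y₁ : ℚ) : ℝ) := exp_neg_le_expUB hNt
      have hE0 : (0 : ℝ) ≤ ((expUB R.Ntail R.y₁ : ℚ) : ℝ) := (Real.exp_pos _).le.trans hexp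
      have hlad : ladder R.μ ((R.y₁ : ℚ) : ℝ) = ((ladderQ R.μ R.y₁ : ℚ) : ℝ) := (ladderQ_cast _ _).symm
      have hlad0 : (0 : ℝ) ≤ ((ladderQ R.μ R.y₁ : ℚ) : ℝ) := by rw [← hlad]; exact (ladder_pos _ hy10).le
      have key : Real.sqrt (π / (2 * ((R.y₁ : ℚ) : ℝ))) * ladder R.μ ((R.y₁ : ℚ) : ℝ) * ((R.y₁ : ℚ) : ℝ) ^ R.μ * Real.exp (-((R.y₁ : ℚ) : ℝ)) ≤
          (R.stail : ℝ) * ((ladderQ R.μ R.y₁ : ℚ) : ℝ) * ((R.y₁ : ℚ) : ℝ) ^ R.μ * ((expUB R.Ntail R.y₁ : ℚ) : ℝ) :=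
        mul_le_mul (mul_le_mul (mul_le_mul hsq hlad.le (ladder_pos _ hy10).le hst0) le_rfl (by positivity) (mul_nonneg hst0 hlad0))
          hexp (Real.exp_pos _).le (by positivity)
      have hC : (1 / (2 * (R.dlo : ℝ) ^ 2)) ^ R.μ *
          (Real.sqrt (π / (2 * ((R.y₁ : ℚ) : ℝ))) * ladder R.μ ((R.y₁ : ℚ) : ℝ) * ((R.y₁ : ℚ) : ℝ) ^ R.μ * Real.exp (-((R.y₁ : ℚ) : ℝ))) ≤
          (R.tailC : ℝ) := by
        refine le_trans (mul_le_mul_of_nonneg_left key (by positivity)) ?_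
        have : (((1 / (2 * R.dlo ^ 2)) ^ R.μ * (R.stail * ladderQ R.μ R.y₁ * R.y₁ ^ R.μ * expUB R.Ntail R.y₁) : ℚ) : ℝ) ≤ R.tailC := by
          exact_mod_cast le_max_right _ _
        refine le_trans (le_of_eq ?_) this
        push_cast; ring
      -- the exponential decay factor
      have hρ : Real.exp (-((R.δ * R.β : ℚ) : ℝ)) ≤ 1 / 2 :=
        (exp_neg_le_expUB hNr).trans (by have := (Rat.cast_le (K := ℝ)).2 hrho; push_cast at this; exact this)
      have hexp2 : Real.exp (-(1 - R.μ / ((R.y₁ : ℚ) : ℝ)) * ((R.β : ℚ) : ℝ) * ((L : ℝ) - ((R.Z : ℝ) + 1))) ≤ (1 / 2 : ℝ) ^ (L - (R.Z + 1)) := by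
        have h := exp_neg_mul_le_half_pow hρ hL
        have he : -((R.δ * R.β : ℚ) : ℝ) * ((L : ℝ) - ((R.Z : ℝ) + 1)) = -(1 - R.μ / ((R.y₁ : ℚ) : ℝ)) * ((R.β : ℚ) : ℝ) * ((L : ℝ) - ((R.Z : ℝ) + 1)) := by
          simp only [δ]; push_cast; ring
        rw [he] at h; exact h
      have hpow : (2 : ℝ) ^ (R.Z + 1) * (1 / 2 : ℝ) ^ L = (1 / 2 : ℝ) ^ (L - (R.Z + 1)) := by
        obtain ⟨m, hm⟩ := Nat.exists_eq_add_of_le hL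
        rw [hm, Nat.add_sub_cancel_left, pow_add (1 / 2 : ℝ) (R.Z + 1) m, ← mul_assoc, ← mul_pow]; norm_num
      calc dualBesselTerm R.μ d ‖w‖ ≤ _ := htail
        _ ≤ (R.tailC : ℝ) * (1 / 2 : ℝ) ^ (L - (R.Z + 1)) := mul_le_mul hC hexp2 (Real.exp_pos _).le htailC
        _ = G z := by rw [hGtail z hbox, hTM]; simp only; rw [← pow_add, ← hLdef, ← hpow]; ring
  -- summation
  have hmain := tsum_dualLattice_le_of_majorant b hspan (fun w => dualBesselTerm R.μ d ‖w‖) hG0 hGs hdom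
  refine hmain.trans ?_
  rw [← hGs.sum_add_tsum_compl (s := S)]
  have hboxsum : ∑ z ∈ S, G z = ((R.boxSum : ℚ) : ℝ) := by
    rw [hS, List.sum_toFinset _ (nodup_boxPts R.Z), boxSum, cast_list_sum_map]
  have htailsum : ∑' z : ↑((↑S : Set (ℤ × ℤ))ᶜ), G z ≤ (R.tailC : ℝ) * 2 ^ (R.Z + 1) * 9 := by
    have h1 : ∀ z : ↑((↑S : Set (ℤ × ℤ))ᶜ), G z = TM z :=
      fun z => hGtail z (fun h => z.2 (Finset.mem_coe.2 ((hmemS z).2 h)))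
    calc ∑' z : ↑((↑S : Set (ℤ × ℤ))ᶜ), G z = ∑' z : ↑((↑S : Set (ℤ × ℤ))ᶜ), TM z := tsum_congr h1
      _ ≤ ∑' z, TM z := Summable.tsum_subtype_le TM _ hTM0 hTMs
      _ = (R.tailC : ℝ) * 2 ^ (R.Z + 1) * 9 := hTMsum.tsum_eq
  have hb : ((R.boxSum : ℚ) : ℝ) + (R.tailC : ℝ) * 2 ^ (R.Z + 1) * 9 ≤ R.bound := by
    have := (Rat.cast_le (K := ℝ)).2 hbound; push_cast at this; exact this
  linarith [hboxsum, htailsum, hb]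

end DualRow

end Sound

end Summit.AtomisticToContinuum.Crystallization.Theorems.OverbindingBudgetAffineFarSmoothSplit

end
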